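import Mathlib
import Summits.NavierStokesRegularity.FluidComputer.AbcInertiaExactlyOne

/-!
# «EXACTLY ONE» at `R = 500`: the X0 bracket and the INERTIA-3L count together — the linearisation about the
# forced ABC flow at viscosity `1/(2π·500)` has EXACTLY ONE classical class-II eigenvalue with `Re z ≥ 6/25`,
# and it is real, in `[0.2802, 0.3002]` (instab3 g8, cell `ns-blowup`, 2026-08-27)

HONEST FRAMING (human rulings D-0035/D-0074): **MODEL linear operator, computer-assisted; not NS.** Nothing
here is a statement about Navier–Stokes regularity or blow-up. Object: the linearisation of forced NS about
`U = abcFlow 1 1 1` on the unit torus at viscosity `1/(2π·500)` (= `R = 500` in certifier units), symmetry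
class II. bears_on LADDER-NS N1* T6 («is class II still the steady leader at R 500; leader flip»).

**`R500II_exactly_one`** — as `AbcInertiaExactlyOne.R300II_exactly_one` with the R 500 cells: X0 row
(T1)(T2) of `SkewCutBracketReproductions.X0R500` (implementation 2, cert.py j249163, `K = 34`) and the INERTIA-3L
cell `(500, II, 6/25, 1; 36, 37)` (implementation 2, INERTIA-I4 §8) in ANY real orthonormal orbit basis family
`e` ⇒ `σ_p(L_500|II) ∩ {Re ≥ 6/25} = {λ⋆}`, `λ⋆ ∈ [0.2802, 0.3002]` real, for classical eigenfunctions (MODEL;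
conditional on the certifier audits; the R 500 INERTIA certificate of implementation 2 was RUNNING at write
time — the theorem is the implication, whatever the verdict).

Mathlib + `AbcInertiaExactlyOne`; no new definitions; std axioms. [folklore]
-/

noncomputable section

open scoped BigOperators ComplexConjugate InnerProductSpace Matrix
open Finset Matrix MeasureTheory UnitAddTorus

namespace Summit.NavierStokesRegularity.FluidComputer.AbcInertia

open Literature.Analysis.FunctionSpaces Literature.Analysis.FunctionSpaces.Torus
open Literature.Analysis.FunctionSpaces.EuclideanSpace
open Literature.Analysis.FluidPDE Literature.Analysis.FluidPDE.SteadyLattice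
open Summit.NavierStokesRegularity.FluidComputer.AbcClassII

section ExactlyOneR500

variable (e : ∀ O : Orbit, OrthonormalBasis (Fin (odim O)) ℝ (realSpace O.1))
variable (bf : Idx → Fam)
variable (hbf : ∀ i : Idx, bf i = extend i.1.1 ((e i.1 i.2 : realSpace i.1.1) : EuclideanSpace ℂ (↥i.1.1 × Fin 3)))
variable (am : Idx → Idx → ℝ)
variable (ham : ∀ i j : Idx, am i j =
  (∑ k ∈ i.1.1, (inner ℂ (bf i k) (Torus.lerayCoeff k (crossForm 1 1 1 (bf j) k)) : ℂ)).re)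

include hbf ham in
/-- **R = 500, CLASS II: EXACTLY ONE classical class-II eigenvalue with `Re z ≥ 6/25`** — the X0 row
(implementation 2: (T1)(T2) of cert.py j249163, `SkewCutBracketReproductions.X0R500`, bracket `[0.2802, 0.3002]`)
and the INERTIA-3L cell `(500, II, 6/25, 1; 36, 37)` (implementation 2, kit j269944/j274818), both stated in the
bases `e`, imply: `∃ λ⋆ ∈ [x₁, x₂]` real with a classical CLASS-II eigenfunction, and every classical class-II
eigenpair `(z, u)` with `Re z ≥ 6/25` has `z = λ⋆`. MODEL; conditional on the two certifier audits. -/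
theorem R500II_exactly_one
    (hdet : (Matrix.of fun a b : ↥(cubeIdx SkewCutBracketReproductions.X0R500.K4) =>
        (if (a : Idx) = b then ((SkewCutBracketReproductions.X0R500.x1 : ℚ) : ℝ) + onormSq (b : Idx).1 / ((SkewCutBracketReproductions.X0R500.R : ℕ) : ℝ) else 0) - am a b).det *
      (Matrix.of fun a b : ↥(cubeIdx SkewCutBracketReproductions.X0R500.K4) =>
        (if (a : Idx) = b then ((SkewCutBracketReproductions.X0R500.x2 : ℚ) : ℝ) + onormSq (b : Idx).1 / ((SkewCutBracketReproductions.X0R500.R : ℕ) : ℝ) else 0) - am a b).det < 0)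
    (hX₁ : ∀ w : ↥(cubeIdx (SkewCutBracketReproductions.X0R500.K4 + 1) \ cubeIdx SkewCutBracketReproductions.X0R500.K4) → ℝ, ((SkewCutBracketReproductions.X0R500.mu2lb1_4 : ℚ) : ℝ) * (w ⬝ᵥ w) ≤
      ∑ a : ↥(cubeIdx (SkewCutBracketReproductions.X0R500.K4 + 1) \ cubeIdx SkewCutBracketReproductions.X0R500.K4), (((SkewCutBracketReproductions.X0R500.x1 : ℚ) : ℝ) + onormSq (a : Idx).1 / ((SkewCutBracketReproductions.X0R500.R : ℕ) : ℝ)) * w a ^ 2 -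
          Real.sqrt 2 * (w ⬝ᵥ w) -
        w ⬝ᵥ (((Matrix.of fun (a : ↥(cubeIdx (SkewCutBracketReproductions.X0R500.K4 + 1) \ cubeIdx SkewCutBracketReproductions.X0R500.K4)) (b : ↥(cubeIdx SkewCutBracketReproductions.X0R500.K4)) =>
            (if (a : Idx) = b then ((SkewCutBracketReproductions.X0R500.x1 : ℚ) : ℝ) + onormSq (b : Idx).1 / ((SkewCutBracketReproductions.X0R500.R : ℕ) : ℝ) else 0) - am a b) *
          (Matrix.of fun a b : ↥(cubeIdx SkewCutBracketReproductions.X0R500.K4) =>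
            (if (a : Idx) = b then ((SkewCutBracketReproductions.X0R500.x1 : ℚ) : ℝ) + onormSq (b : Idx).1 / ((SkewCutBracketReproductions.X0R500.R : ℕ) : ℝ) else 0) - am a b)⁻¹ *
          (Matrix.of fun (a : ↥(cubeIdx SkewCutBracketReproductions.X0R500.K4)) (b : ↥(cubeIdx (SkewCutBracketReproductions.X0R500.K4 + 1) \ cubeIdx SkewCutBracketReproductions.X0R500.K4)) =>
            (if (a : Idx) = b then ((SkewCutBracketReproductions.X0R500.x1 : ℚ) : ℝ) + onormSq (b : Idx).1 / ((SkewCutBracketReproductions.X0R500.R : ℕ) : ℝ) else 0) - am a b)) *ᵥ w))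
    (hX₂ : ∀ w : ↥(cubeIdx (SkewCutBracketReproductions.X0R500.K4 + 1) \ cubeIdx SkewCutBracketReproductions.X0R500.K4) → ℝ, ((SkewCutBracketReproductions.X0R500.mu2lb2_4 : ℚ) : ℝ) * (w ⬝ᵥ w) ≤
      ∑ a : ↥(cubeIdx (SkewCutBracketReproductions.X0R500.K4 + 1) \ cubeIdx SkewCutBracketReproductions.X0R500.K4), (((SkewCutBracketReproductions.X0R500.x2 : ℚ) : ℝ) + onormSq (a : Idx).1 / ((SkewCutBracketReproductions.X0R500.R : ℕ) : ℝ)) * w a ^ 2 -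
          Real.sqrt 2 * (w ⬝ᵥ w) -
        w ⬝ᵥ (((Matrix.of fun (a : ↥(cubeIdx (SkewCutBracketReproductions.X0R500.K4 + 1) \ cubeIdx SkewCutBracketReproductions.X0R500.K4)) (b : ↥(cubeIdx SkewCutBracketReproductions.X0R500.K4)) =>
            (if (a : Idx) = b then ((SkewCutBracketReproductions.X0R500.x2 : ℚ) : ℝ) + onormSq (b : Idx).1 / ((SkewCutBracketReproductions.X0R500.R : ℕ) : ℝ) else 0) - am a b) *
          (Matrix.of fun a b : ↥(cubeIdx SkewCutBracketReproductions.X0R500.K4) =>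
            (if (a : Idx) = b then ((SkewCutBracketReproductions.X0R500.x2 : ℚ) : ℝ) + onormSq (b : Idx).1 / ((SkewCutBracketReproductions.X0R500.R : ℕ) : ℝ) else 0) - am a b)⁻¹ *
          (Matrix.of fun (a : ↥(cubeIdx SkewCutBracketReproductions.X0R500.K4)) (b : ↥(cubeIdx (SkewCutBracketReproductions.X0R500.K4 + 1) \ cubeIdx SkewCutBracketReproductions.X0R500.K4)) =>
            (if (a : Idx) = b then ((SkewCutBracketReproductions.X0R500.x2 : ℚ) : ℝ) + onormSq (b : Idx).1 / ((SkewCutBracketReproductions.X0R500.R : ℕ) : ℝ) else 0) - am a b)) *ᵥ w))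
    {HL HH HB : Finset Idx}
    (hHL : ∀ i : Idx, i ∈ HL ↔ onormSq i.1 ≤ (36 : ℝ) ^ 2)
    (hHH : ∀ i : Idx, i ∈ HH ↔ onormSq i.1 ≤ (37 : ℝ) ^ 2)
    (hHB : ∀ i : Idx, i ∈ HB ↔ (37 : ℝ) ^ 2 < onormSq i.1 ∧ onormSq i.1 ≤ ((37 : ℝ) + 1) ^ 2)
    (GH' Ah' : Matrix ↥HH ↥HH ℝ) (AHB' : Matrix ↥HH ↥HB ℝ) (ABH' : Matrix ↥HB ↥HH ℝ) (E : ↥HB → ℝ)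
    (V' : Matrix ↥HH (Fin 1) ℝ) (hGH' : GH'ᵀ = GH')
    (hAh' : Ah' = Matrix.of fun i j : ↥HH =>
      (if i = j then -(onormSq i.1.1 / (500 : ℝ)) - (6 / 25 : ℝ) else 0) + am i.1 j.1)
    (hAHB' : AHB' = Matrix.of fun (i : ↥HH) (l : ↥HB) => am i.1 l.1)
    (hABH' : ABH' = Matrix.of fun (l : ↥HB) (i : ↥HH) => am l.1 i.1)
    (hE : E = fun l : ↥HB => onormSq l.1.1 / (500 : ℝ) + (6 / 25 : ℝ) - Real.sqrt 2)
    (hR1' : ∀ x : ↥HH → ℝ, x ≠ 0 →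
      x ⬝ᵥ ((GH' * Ah' + Ah'ᵀ * GH' + (1 / 2 : ℝ) • ((GH' * AHB' + ABH'ᵀ) * Matrix.diagonal (fun l => (E l)⁻¹) *
        (GH' * AHB' + ABH'ᵀ)ᵀ)) *ᵥ x) < 0)
    (hR2' : ∀ x : ↥HH → ℝ, 0 ≤ x ⬝ᵥ ((GH' + V' * V'ᵀ) *ᵥ x)) :
    ∃ lam : ℝ, lam ∈ Set.Icc ((SkewCutBracketReproductions.X0R500.x1 : ℚ) : ℝ) ((SkewCutBracketReproductions.X0R500.x2 : ℚ) : ℝ) ∧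
      (∃ u : UnitAddTorus (Fin 3) → EuclideanSpace ℂ (Fin 3),
        Torus.LinNSResolventRel (1 / (2 * Real.pi * (500 : ℝ))) (Torus.abcFlow 1 1 1) (2 * Real.pi * (lam : ℂ)) u 0 ∧
          u ≠ 0 ∧ IsClassII (mFourierCoeff u)) ∧
      ∀ (z : ℂ) (u : UnitAddTorus (Fin 3) → EuclideanSpace ℂ (Fin 3)),
        Torus.LinNSResolventRel (1 / (2 * Real.pi * (500 : ℝ))) (Torus.abcFlow 1 1 1) (2 * Real.pi * z) u 0 →
          u ≠ 0 → IsClassII (mFourierCoeff u) → (6 / 25 : ℝ) ≤ z.re → z = lam := by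
  have hs := AbcClassII.sqrt_two_lt
  have hR500 : ((SkewCutBracketReproductions.X0R500.R : ℕ) : ℝ) = 500 := by simp only [SkewCutBracketReproductions.X0R500.R]; norm_num
  -- the X0 coordinate eigenvector
  obtain ⟨lam, hlam, wc, hwc0, hwcr, hwce⟩ :=
    coordinates_of_certificate_of_bases e bf hbf am ham (R := ((SkewCutBracketReproductions.X0R500.R : ℕ) : ℝ)) (by rw [hR500]; norm_num)
      SkewCutBracketReproductions.X0R500.K4 (x₁ := ((SkewCutBracketReproductions.X0R500.x1 : ℚ) : ℝ)) (x₂ := ((SkewCutBracketReproductions.X0R500.x2 : ℚ) : ℝ))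
      (by simp only [SkewCutBracketReproductions.X0R500.x1, SkewCutBracketReproductions.X0R500.x2]; push_cast; norm_num)
      ((SkewCutBracketReproductions.X0R500.mu2lb1_4 : ℚ) : ℝ) ((SkewCutBracketReproductions.X0R500.mu2lb2_4 : ℚ) : ℝ)
      (by simp only [SkewCutBracketReproductions.X0R500.mu2lb1_4]; push_cast; norm_num)
      (by simp only [SkewCutBracketReproductions.X0R500.mu2lb2_4]; push_cast; norm_num)
      (by simp only [SkewCutBracketReproductions.X0R500.R, SkewCutBracketReproductions.X0R500.K4, SkewCutBracketReproductions.X0R500.x1, SkewCutBracketReproductions.X0R500.mu2lb1_4]; push_cast; nlinarith [hs])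
      (by simp only [SkewCutBracketReproductions.X0R500.R, SkewCutBracketReproductions.X0R500.K4, SkewCutBracketReproductions.X0R500.x2, SkewCutBracketReproductions.X0R500.mu2lb2_4]; push_cast; nlinarith [hs])
      hdet hX₁ hX₂
  rw [hR500] at hwce
  -- the classical class-II eigenfunction
  obtain ⟨u₀, hu₀, hu₀0, hu₀II⟩ :=
    classII_eigenfunction_of_coordinates (R := (500 : ℝ)) (by norm_num) (lam : ℂ) wc hwcr hwc0 hwce
  -- the count in classical form, from the INERTIA-3L cell in the bases `e`
  have hcell := fun {n : ℕ} (z : Fin n → ℂ) (hz : Function.Injective z)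
      (u : Fin n → UnitAddTorus (Fin 3) → EuclideanSpace ℂ (Fin 3))
      (hu : ∀ k, Torus.LinNSResolventRel (1 / (2 * Real.pi * (500 : ℝ))) (Torus.abcFlow 1 1 1)
        (2 * Real.pi * z k) (u k) 0)
      (hu0 : ∀ k, u k ≠ 0) (hII : ∀ k, IsClassII (mFourierCoeff (u k))) (hre : ∀ k, (6 / 25 : ℝ) ≤ (z k).re) =>
    card_classII_eigenfunctions_le_of_inertia_certificate_of_bases e bf hbf am ham (R := 500) (a := 6 / 25)
      (rL := 36) (rH := 37) (m := 1) (by norm_num) (by norm_num) (by norm_num) hHL hHH hHB GH' Ah' AHB' ABH' E V'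
      hGH' hAh' hAHB' hABH' hE hR1' hR2' R3_500_37 z hz u hu hu0 hII hre
  -- λ⋆ lies right of a = 6/25
  have hx1 : (6 / 25 : ℝ) < ((SkewCutBracketReproductions.X0R500.x1 : ℚ) : ℝ) := by
    simp only [SkewCutBracketReproductions.X0R500.x1]; push_cast; norm_num
  have hlamre : (6 / 25 : ℝ) ≤ ((lam : ℝ) : ℂ).re := by
    rw [Complex.ofReal_re]; exact hx1.le.trans hlam.1
  refine ⟨lam, hlam, ⟨u₀, hu₀, hu₀0, hu₀II⟩, fun z u hu hu0 huII hzre => ?_⟩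
  exact eq_leader_of_card_le_one (ν := 1 / (2 * Real.pi * (500 : ℝ))) (a := 6 / 25)
    (fun z hz u hu hu0 hII hre => hcell z hz u hu hu0 hII hre) (lam : ℂ) u₀ hu₀ hu₀0 hu₀II hlamre z u hu hu0 huII hzre

end ExactlyOneR500

end Summit.NavierStokesRegularity.FluidComputer.AbcInertia

end
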